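import Literature.NumberTheory.Transcendental.GenusZeroProductType
import Mathlib.Analysis.Calculus.FDeriv.Mul
import Mathlib.Analysis.Calculus.FDeriv.Pi
import Mathlib.Analysis.Calculus.Deriv.Inv
import HarnessLib

/-!
# Product maps of `M_{0,n}` in simplicial coordinates: properties of the maps

Companion of `GenusZeroProductType.lean` (definition request `defn-GenusZeroProductType`). Proved
here, for the relabelling transports `KZ.relabelTransport k σ` and the product maps
`KZ.GenusZeroProductType.prodMap`:

* `KZ.markedPoint_relabelTransport` — the marked points of `T_σ t` are the `(σ⁻¹ 0, σ⁻¹ (k+1))`-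
  normalised marked points of `t`, relabelled by `σ`;
* `KZ.relabelTransport_mem_shuffleCell`, `KZ.relabelTransport_symm_relabelTransport`,
  `KZ.injOn_relabelTransport`, `KZ.image_relabelTransport` — `T_σ` maps the standard cell `Δ_k`
  bijectively onto the cell `X_σ`, with inverse `T_{σ⁻¹}` (BCS 2010, §2.3.3: relabelling permutes
  the cells);
* `KZ.isSemialgebraicMapOn_relabelTransport`, `KZ.differentiableAt_relabelTransport` — `T_σ` is a
  `ℚ`-semialgebraic (rational) map, differentiable off its polar hyperplane;
* `KZ.relabel_sub_mem_changeOfVariablesRel` — **the relabelling move**: for representations `r` on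
  `Δ_k` and `r'` on `X_σ` with `r.integrand = (r'.integrand ∘ T_σ)·|det DT_σ|`, `[r] − [r']` is ONE
  element of `KZ.changeOfVariablesRel` (Kontsevich–Zagier's rule 2), unconditionally;
* `KZ.GenusZeroProductType.prodMap_mem_simplexProd` — `f` maps every shuffle cell into
  `Δ_a × Δ_b` (Brown 2009, §2.7: `f(X_{S,γ}) ⊆ ∏ X_{Tᵢ,δᵢ}` for `γ ∈ G_f`);
* `KZ.GenusZeroProductType.injOn_prodMap` — `f` is injective on the generic locus (pairwise
  distinct marked points), in particular on every cell: the product of forgetful maps is an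
  embedding (Brown 2009, §2.7; BCS 2010, §2.3.2 "birational embedding");
* `KZ.GenusZeroProductType.isSemialgebraicMapOn_prodMap`, `differentiableAt_prodMap`;
* `KZ.eq_of_mem_shuffleCell`, `KZ.disjoint_shuffleCell`, `KZ.GenusZeroProductType.disjoint_image_prodMap`
  — distinct arrangements have disjoint cells, and so do their images under `f` (the disjointness
  half of `f⁻¹(Δ_a × Δ_b) = ⊔_σ X_σ`, BCS Prop. 2.19);
* `KZ.genericLocus k` — the points of `ℝ^k` with pairwise distinct marked points (the real points
  of `M_{0,k+3}` in the simplicial chart): open, contains every cell, stable under transports.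

Not here: the Jacobian formulas `|det DT_σ| = relabelAbsDet` (`GenusZeroProductTypeJacobian.lean`)
and `|det Df| = prodMapAbsDet` (`GenusZeroProductTypeProdJacobian.lean`), the covering of
`Δ_a × Δ_b` by the images `f(X_σ)` up to a null set (`GenusZeroProductTypeCover.lean`) and the
dissection itself (`GenusZeroProductTypeDissection.lean`).

## References

* F. Brown, S. Carr, L. Schneps, Compositio Math. 146 (2010) [BrownCarrSchneps2010], §2.3.2–2.3.3,
  Prop. 2.19.
* F. Brown, Ann. Sci. ÉNS 42 (2009) [BrownENS2009], §2.3, §2.7.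
* M. Kontsevich, D. Zagier, *Periods* (2001) [KontsevichZagier2001], §1.2 rule (2).
-/

noncomputable section

open MeasureTheory MvPolynomial Set Finset

namespace Literature.NumberTheory.Transcendental

namespace KZ

variable {k : ℕ}

/-! ### Calculus of marked points -/

/-- Each marked point is a differentiable (affine) function of `t`. [folklore] -/
theorem differentiableAt_markedPoint (s : Fin (k + 2)) (t : Fin k → ℝ) :
    DifferentiableAt ℝ (fun t : Fin k → ℝ => markedPoint k t s) t := by
  rcases eq_zero_or_eq_last_or_exists_eq_coordLabel s with rfl | rfl | ⟨i, rfl⟩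
  · simp only [markedPoint_zero]; exact differentiableAt_const _
  · simp only [markedPoint_last]; exact differentiableAt_const _
  · simp only [markedPoint_coordLabel]; exact differentiableAt_apply i t

/-- `pointRatio α β c` is differentiable wherever `m_β ≠ m_α`. [folklore] -/
theorem differentiableAt_pointRatio (α β c : Fin (k + 2)) {t : Fin k → ℝ}
    (h : markedPoint k t β - markedPoint k t α ≠ 0) :
    DifferentiableAt ℝ (pointRatio k α β c) t := by
  have e : pointRatio k α β c = fun t =>
      (markedPoint k t c - markedPoint k t α) / (markedPoint k t β - markedPoint k t α) := rfl
  have h1 : DifferentiableAt ℝ (fun t => markedPoint k t c - markedPoint k t α) t :=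
    (differentiableAt_markedPoint c t).sub (differentiableAt_markedPoint α t)
  have h2 : DifferentiableAt ℝ (fun t => markedPoint k t β - markedPoint k t α) t :=
    (differentiableAt_markedPoint β t).sub (differentiableAt_markedPoint α t)
  rw [e]
  simp only [div_eq_mul_inv]
  exact h1.mul (h2.inv h)

/-- `pointRatio α β c` is a `ℚ`-semialgebraic function on every `ℚ`-semialgebraic set on which
`m_β ≠ m_α` (a quotient of polynomials over `ℚ`). [Kontsevich–Zagier 2001, §1.1] [folklore] -/
theorem isSemialgebraicFunOn_pointRatio (α β c : Fin (k + 2)) {s : Set (Fin k → ℝ)}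
    (hs : Literature.ModelTheory.ExponentialFields.IsSemialgebraic ℚ s)
    (h : ∀ t ∈ s, markedPoint k t β - markedPoint k t α ≠ 0) :
    IsSemialgebraicFunOn ℚ s (pointRatio k α β c) := by
  have h' : ∀ t ∈ s, aeval t (markedPoly k β - markedPoly k α) ≠ 0 := fun t ht => by
    simpa using h t ht
  refine (isSemialgebraicFunOn_aeval_div_aeval hs (markedPoly k c - markedPoly k α)
    (markedPoly k β - markedPoly k α) h').congr fun t _ => ?_
  simp [pointRatio]

/-- On the standard cell the marked points increase with the label. [Brown–Carr–Schneps 2010, Def. 2.6] [folklore] -/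
theorem strictMono_markedPoint_of_mem_openOrderedSimplex {t : Fin k → ℝ}
    (ht : t ∈ openOrderedSimplex k) : StrictMono (markedPoint k t) := by
  rw [← shuffleCell_one] at ht
  simpa [mem_shuffleCell_iff] using ht

/-- A point whose marked points increase with the label lies in the standard cell. [folklore] -/
theorem mem_openOrderedSimplex_of_strictMono {t : Fin k → ℝ} (ht : StrictMono (markedPoint k t)) :
    t ∈ openOrderedSimplex k := by
  rw [← shuffleCell_one]
  simpa [mem_shuffleCell_iff] using ht


/-! ### Cells are the fibres of the order type -/

/-- **Distinct arrangements have disjoint cells**: the arrangement of a point of a cell is the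
order in which its marked points lie on the line. [Brown 2009, §2.7 ("the cells `X_{S,γ}` cover
`M_{0,S}(ℝ)` disjointly")] [folklore] -/
theorem eq_of_mem_shuffleCell {σ τ : Equiv.Perm (Fin (k + 2))} {t : Fin k → ℝ}
    (hσ : t ∈ shuffleCell k σ) (hτ : t ∈ shuffleCell k τ) : σ = τ := by
  have hrange : Set.range (markedPoint k t ∘ σ) = Set.range (markedPoint k t ∘ τ) := by
    rw [Set.range_comp, Set.range_comp, Equiv.range_eq_univ, Equiv.range_eq_univ]
  have h := (StrictMono.range_inj hσ hτ).mp hrange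
  ext p
  exact congr_arg Fin.val (injective_markedPoint_of_mem_shuffleCell hσ (congr_fun h p))

/-- Distinct arrangements have disjoint cells. [Brown 2009, §2.7] [folklore] -/
theorem disjoint_shuffleCell {σ τ : Equiv.Perm (Fin (k + 2))} (h : σ ≠ τ) :
    Disjoint (shuffleCell k σ) (shuffleCell k τ) :=
  Set.disjoint_left.mpr fun _ hσ hτ => h (eq_of_mem_shuffleCell hσ hτ)

/-! ### The relabelling transport `T_σ : Δ_k → X_σ` -/

section Relabel

variable (σ : Equiv.Perm (Fin (k + 2)))

/-- On the standard cell the denominator of `T_σ` is positive as soon as label `0` precedes label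
`k + 1` in `σ` (e.g. for shuffles). [folklore] -/
theorem relabelDen_pos {t : Fin k → ℝ} (hσ : σ.symm 0 < σ.symm (Fin.last (k + 1)))
    (ht : t ∈ openOrderedSimplex k) : 0 < relabelDen k σ t :=
  sub_pos.mpr (strictMono_markedPoint_of_mem_openOrderedSimplex ht hσ)

/-- **Marked points of the transported point**: `m_s(T_σ t)` is the `(σ⁻¹ 0, σ⁻¹ (k+1))`-normalised
marked point `σ⁻¹ s` of `t`, for EVERY label `s` (including `0 ↦ 0` and `k + 1 ↦ 1`).
[Brown–Carr–Schneps 2010, §2.3.3] [folklore] -/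
theorem markedPoint_relabelTransport {t : Fin k → ℝ} (hD : relabelDen k σ t ≠ 0) (s : Fin (k + 2)) :
    markedPoint k (relabelTransport k σ t) s =
      pointRatio k (σ.symm 0) (σ.symm (Fin.last (k + 1))) (σ.symm s) t := by
  rcases eq_zero_or_eq_last_or_exists_eq_coordLabel s with rfl | rfl | ⟨i, rfl⟩
  · rw [markedPoint_zero, pointRatio_left]
  · rw [markedPoint_last, pointRatio_right hD]
  · rw [markedPoint_coordLabel]; rfl

/-- `T_σ` maps the standard cell into the cell `X_σ`. [Brown–Carr–Schneps 2010, §2.3.3] [folklore] -/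
theorem relabelTransport_mem_shuffleCell {t : Fin k → ℝ} (hσ : σ.symm 0 < σ.symm (Fin.last (k + 1)))
    (ht : t ∈ openOrderedSimplex k) : relabelTransport k σ t ∈ shuffleCell k σ := by
  have hD := relabelDen_pos σ hσ ht
  have hm := strictMono_markedPoint_of_mem_openOrderedSimplex ht
  rw [mem_shuffleCell_iff]
  intro p q hpq
  simp only [Function.comp_apply, markedPoint_relabelTransport σ hD.ne', Equiv.symm_apply_apply,
    pointRatio]
  exact div_lt_div_of_pos_right (sub_lt_sub_right (hm hpq) _) hD

/-- The denominator of `T_{σ⁻¹}` at `T_σ t` is the inverse of that of `T_σ` at `t`. [folklore] -/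
theorem relabelDen_symm_relabelTransport {t : Fin k → ℝ} (hD : relabelDen k σ t ≠ 0) :
    relabelDen k σ.symm (relabelTransport k σ t) = (relabelDen k σ t)⁻¹ := by
  rw [relabelDen, markedPoint_relabelTransport σ hD, markedPoint_relabelTransport σ hD]
  simp only [Equiv.symm_symm, Equiv.symm_apply_apply, pointRatio, markedPoint_last,
    markedPoint_zero, div_sub_div_same]
  rw [inv_eq_one_div, relabelDen]
  congr 1
  ring

/-- **`T_{σ⁻¹}` undoes `T_σ`** wherever `T_σ` is defined: relabelling is an action.
[Brown–Carr–Schneps 2010, §2.3.3] [folklore] -/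
theorem relabelTransport_symm_relabelTransport {t : Fin k → ℝ} (hD : relabelDen k σ t ≠ 0) :
    relabelTransport k σ.symm (relabelTransport k σ t) = t := by
  have hD' : relabelDen k σ.symm (relabelTransport k σ t) ≠ 0 := by
    rw [relabelDen_symm_relabelTransport σ hD]; exact inv_ne_zero hD
  apply eq_of_markedPoint_eq
  funext s
  rw [markedPoint_relabelTransport σ.symm hD' s, pointRatio_def]
  simp only [markedPoint_relabelTransport σ hD, Equiv.symm_symm, Equiv.symm_apply_apply]
  rw [pointRatio_pointRatio hD, pointRatio_zero_last]

/-- `T_σ` is injective off its polar hyperplane `{relabelDen = 0}` (in particular on the standard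
cell, for shuffles). [Brown–Carr–Schneps 2010, §2.3.3] [folklore] -/
theorem injOn_relabelTransport : InjOn (relabelTransport k σ) {t | relabelDen k σ t ≠ 0} := by
  intro t ht t' ht' h
  rw [← relabelTransport_symm_relabelTransport σ (t := t) ht,
    ← relabelTransport_symm_relabelTransport σ (t := t') ht', h]

/-- **`T_σ(Δ_k) = X_σ`**: the relabelling carries the standard cell onto the cell `X_σ`
(for `σ` with label `0` before label `k + 1`, e.g. every shuffle).
[Brown–Carr–Schneps 2010, §2.3.3, eq. (2.17)] [folklore] -/
theorem image_relabelTransport (hσ : σ.symm 0 < σ.symm (Fin.last (k + 1))) :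
    relabelTransport k σ '' openOrderedSimplex k = shuffleCell k σ := by
  refine Subset.antisymm (image_subset_iff.mpr fun t ht => relabelTransport_mem_shuffleCell σ hσ ht)
    fun t' ht' => ?_
  have hm' : StrictMono (markedPoint k t' ∘ σ) := ht'
  have hD' : 0 < relabelDen k σ.symm t' := by
    simpa [relabelDen] using hm' (Fin.last_pos' (n := k + 1))
  refine ⟨relabelTransport k σ.symm t', ?_, ?_⟩
  · apply mem_openOrderedSimplex_of_strictMono
    intro x y hxy
    rw [markedPoint_relabelTransport σ.symm hD'.ne', markedPoint_relabelTransport σ.symm hD'.ne']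
    simp only [Equiv.symm_symm, pointRatio]
    exact div_lt_div_of_pos_right (sub_lt_sub_right (hm' hxy) _) hD'
  · simpa using relabelTransport_symm_relabelTransport σ.symm (t := t') hD'.ne'

/-- `T_σ` is a `ℚ`-semialgebraic map on every `ℚ`-semialgebraic set avoiding its polar hyperplane
(each coordinate is a quotient of polynomials over `ℚ`). [Kontsevich–Zagier 2001, §1.2 rule (2)] [folklore] -/
theorem isSemialgebraicMapOn_relabelTransport {s : Set (Fin k → ℝ)}
    (hs : Literature.ModelTheory.ExponentialFields.IsSemialgebraic ℚ s)
    (hD : ∀ t ∈ s, relabelDen k σ t ≠ 0) : IsSemialgebraicMapOn ℚ s (relabelTransport k σ) :=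
  IsSemialgebraicMapOn.of_forall hs fun _ =>
    isSemialgebraicFunOn_pointRatio _ _ _ hs hD

/-- `T_σ` is differentiable off its polar hyperplane. [folklore] -/
theorem differentiableAt_relabelTransport {t : Fin k → ℝ} (hD : relabelDen k σ t ≠ 0) :
    DifferentiableAt ℝ (relabelTransport k σ) t :=
  differentiableAt_pi.mpr fun _ => differentiableAt_pointRatio _ _ _ hD

/-- **The relabelling move.** For an arrangement `σ` with label `0` before label `k + 1` (e.g. a
shuffle of a product type), a representation `r` on the standard cell `Δ_k` and a representation
`r'` on the cell `X_σ` whose integrands satisfy `r.integrand t = r'.integrand (T_σ t)·|det DT_σ(t)|`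
on `Δ_k`, the element `[r] − [r']` is ONE change-of-variables move of the KZ calculus
(`Φ = T_σ`: `ℚ`-semialgebraic, differentiable, injective on `Δ_k`, `T_σ(Δ_k) = X_σ`). This is the
calculus form of `∫_{X_γ} ω = ∫_{X_{τ(γ)}} ω_{τ(·)}` (relabelling of marked points).
[Brown–Carr–Schneps 2010, §2.3.3 eq. (2.17); Kontsevich–Zagier 2001, §1.2 rule (2)] [cite: KontsevichZagier2001, §1.2 rule (2)] -/
theorem relabel_sub_mem_changeOfVariablesRel (hσ : σ.symm 0 < σ.symm (Fin.last (k + 1)))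
    (r r' : IntegralRep k) (hr : r.domain = openOrderedSimplex k) (hr' : r'.domain = shuffleCell k σ)
    (hint : ∀ t ∈ openOrderedSimplex k,
      r.integrand t = r'.integrand (relabelTransport k σ t) * |(fderiv ℝ (relabelTransport k σ) t).det|) :
    of r - of r' ∈ changeOfVariablesRel := by
  have hD : ∀ t ∈ r.domain, relabelDen k σ t ≠ 0 := fun t ht =>
    (relabelDen_pos σ hσ (hr ▸ ht)).ne'
  refine ⟨k, r, r', relabelTransport k σ, fun t => fderiv ℝ (relabelTransport k σ) t, ?_, ?_, ?_,
    ?_, ?_, rfl⟩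
  · exact isSemialgebraicMapOn_relabelTransport σ r.isSemialgebraic_domain hD
  · exact fun t ht => (differentiableAt_relabelTransport σ (hD t ht)).hasFDerivAt.hasFDerivWithinAt
  · exact (injOn_relabelTransport σ).mono fun t ht => hD t ht
  · rw [hr', hr, image_relabelTransport σ hσ]
  · intro t ht
    exact hint t (hr ▸ ht)

end Relabel

/-! ### The generic locus under transports -/

/-- Transports preserve the generic locus (they permute the marked points and apply an injective
affine map to them). [Brown–Carr–Schneps 2010, §2.3.3] [folklore] -/
theorem relabelTransport_mem_genericLocus (σ : Equiv.Perm (Fin (k + 2))) {t : Fin k → ℝ}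
    (ht : t ∈ genericLocus k) : relabelTransport k σ t ∈ genericLocus k := by
  have hD := relabelDen_ne_zero_of_mem_genericLocus σ ht
  have hD' : markedPoint k t (σ.symm (Fin.last (k + 1))) - markedPoint k t (σ.symm 0) ≠ 0 := hD
  intro x y hxy
  rw [markedPoint_relabelTransport σ hD, markedPoint_relabelTransport σ hD] at hxy
  simp only [pointRatio] at hxy
  rw [div_left_inj' hD', sub_left_inj] at hxy
  exact σ.symm.injective (ht hxy)

/-! ### The product map on the shuffle cells -/

namespace GenusZeroProductType

variable {a b : ℕ} (T : GenusZeroProductType a b)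

/-- On a shuffle cell, the marked points of `A` increase with the label. [Brown 2009, §2.7] [folklore] -/
theorem markedPoint_lt_of_mem_A {σ : Equiv.Perm (Fin (a + b + 2))} (hσ : T.IsShuffle σ)
    {t : Fin (a + b) → ℝ} (ht : t ∈ shuffleCell (a + b) σ) {x y : Fin (a + b + 2)}
    (hx : x ∈ T.A) (hy : y ∈ T.A) (hxy : x < y) :
    markedPoint (a + b) t x < markedPoint (a + b) t y :=
  (markedPoint_lt_markedPoint_iff ht).mpr (hσ.1 x hx y hy hxy)

/-- On a shuffle cell, the marked points of `B` increase with the label. [Brown 2009, §2.7] [folklore] -/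
theorem markedPoint_lt_of_mem_B {σ : Equiv.Perm (Fin (a + b + 2))} (hσ : T.IsShuffle σ)
    {t : Fin (a + b) → ℝ} (ht : t ∈ shuffleCell (a + b) σ) {x y : Fin (a + b + 2)}
    (hx : x ∈ T.B) (hy : y ∈ T.B) (hxy : x < y) :
    markedPoint (a + b) t x < markedPoint (a + b) t y :=
  (markedPoint_lt_markedPoint_iff ht).mpr (hσ.2 x hx y hy hxy)

/-- `f_A` has positive denominator on every shuffle cell. [folklore] -/
theorem denA_pos {σ : Equiv.Perm (Fin (a + b + 2))} (hσ : T.IsShuffle σ) {t : Fin (a + b) → ℝ}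
    (ht : t ∈ shuffleCell (a + b) σ) : 0 < T.denA t :=
  sub_pos.mpr (T.markedPoint_lt_of_mem_A hσ ht T.minA_mem T.maxA_mem T.minA_lt_maxA)

/-- `f_B` has positive denominator on every shuffle cell. [folklore] -/
theorem denB_pos {σ : Equiv.Perm (Fin (a + b + 2))} (hσ : T.IsShuffle σ) {t : Fin (a + b) → ℝ}
    (ht : t ∈ shuffleCell (a + b) σ) : 0 < T.denB t :=
  sub_pos.mpr (T.markedPoint_lt_of_mem_B hσ ht T.minB_mem T.maxB_mem T.minB_lt_maxB)

/-- **`f` maps every shuffle cell into `Δ_a × Δ_b`** (`f(X_{S,γ}) ⊆ X_{T₁,δ₁} × X_{T₂,δ₂}` for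
`γ ∈ G_f`). [Brown 2009, §2.7 (before eq. (2.34)); Brown–Carr–Schneps 2010, Prop. 2.19] [cite: BrownENS2009, §2.7] -/
theorem prodMap_mem_simplexProd {σ : Equiv.Perm (Fin (a + b + 2))} (hσ : T.IsShuffle σ)
    {t : Fin (a + b) → ℝ} (ht : t ∈ shuffleCell (a + b) σ) : T.prodMap t ∈ simplexProd a b := by
  have hA : 0 < markedPoint (a + b) t T.maxA - markedPoint (a + b) t T.minA := T.denA_pos hσ ht
  have hB : 0 < markedPoint (a + b) t T.maxB - markedPoint (a + b) t T.minB := T.denB_pos hσ ht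
  simp only [simplexProd, mem_setOf_eq, prodMap_castAdd, prodMap_natAdd, openOrderedSimplex]
  refine ⟨⟨fun i => ?_, fun i => ?_, fun i j hij => ?_⟩, ⟨fun i => ?_, fun i => ?_, fun i j hij => ?_⟩⟩
  · exact div_pos (sub_pos.mpr (T.markedPoint_lt_of_mem_A hσ ht T.minA_mem (T.innerLabelA_mem i)
      (T.minA_lt_innerLabelA i))) hA
  · rw [normA, pointRatio, div_lt_one hA]
    exact sub_lt_sub_right (T.markedPoint_lt_of_mem_A hσ ht (T.innerLabelA_mem i) T.maxA_mem
      (T.innerLabelA_lt_maxA i)) _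
  · exact div_lt_div_of_pos_right (sub_lt_sub_right (T.markedPoint_lt_of_mem_A hσ ht
      (T.innerLabelA_mem j) (T.innerLabelA_mem i) (T.strictAnti_innerLabelA hij)) _) hA
  · exact div_pos (sub_pos.mpr (T.markedPoint_lt_of_mem_B hσ ht T.minB_mem (T.innerLabelB_mem i)
      (T.minB_lt_innerLabelB i))) hB
  · rw [normB, pointRatio, div_lt_one hB]
    exact sub_lt_sub_right (T.markedPoint_lt_of_mem_B hσ ht (T.innerLabelB_mem i) T.maxB_mem
      (T.innerLabelB_lt_maxB i)) _
  · exact div_lt_div_of_pos_right (sub_lt_sub_right (T.markedPoint_lt_of_mem_B hσ ht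
      (T.innerLabelB_mem j) (T.innerLabelB_mem i) (T.strictAnti_innerLabelB hij)) _) hB

/-- A label of `A` is its minimum, its maximum, or an inner label. [folklore] -/
theorem eq_minA_or_eq_maxA_or_exists {x : Fin (a + b + 2)} (hx : x ∈ T.A) :
    x = T.minA ∨ x = T.maxA ∨ ∃ i, x = T.innerLabelA i := by
  by_cases h1 : x = T.minA
  · exact Or.inl h1
  by_cases h2 : x = T.maxA
  · exact Or.inr (Or.inl h2)
  refine Or.inr (Or.inr (T.exists_eq_innerLabelA (T.mem_innerA_iff.mpr ⟨hx, ?_, ?_⟩)))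
  · exact lt_of_le_of_ne (T.minA_le hx) (Ne.symm h1)
  · exact lt_of_le_of_ne (T.le_maxA hx) h2

/-- A label of `B` is its minimum, its maximum, or an inner label. [folklore] -/
theorem eq_minB_or_eq_maxB_or_exists {x : Fin (a + b + 2)} (hx : x ∈ T.B) :
    x = T.minB ∨ x = T.maxB ∨ ∃ j, x = T.innerLabelB j := by
  by_cases h1 : x = T.minB
  · exact Or.inl h1
  by_cases h2 : x = T.maxB
  · exact Or.inr (Or.inl h2)
  refine Or.inr (Or.inr (T.exists_eq_innerLabelB (T.mem_innerB_iff.mpr ⟨hx, ?_, ?_⟩)))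
  · exact lt_of_le_of_ne (T.minB_le hx) (Ne.symm h1)
  · exact lt_of_le_of_ne (T.le_maxB hx) h2

/-- `f_A(t)` determines the `(min A, max A)`-normalised positions of all points of `A`. [folklore] -/
theorem pointRatio_minA_maxA_eq_of_normA_eq {t t' : Fin (a + b) → ℝ} (hd : T.denA t ≠ 0)
    (hd' : T.denA t' ≠ 0) (h : T.normA t = T.normA t') {x : Fin (a + b + 2)} (hx : x ∈ T.A) :
    pointRatio (a + b) T.minA T.maxA x t = pointRatio (a + b) T.minA T.maxA x t' := by
  rcases T.eq_minA_or_eq_maxA_or_exists hx with rfl | rfl | ⟨i, rfl⟩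
  · rw [pointRatio_left, pointRatio_left]
  · rw [pointRatio_right hd, pointRatio_right hd']
  · exact congr_fun h i

/-- `f_B(t)` determines the `(min B, max B)`-normalised positions of all points of `B`. [folklore] -/
theorem pointRatio_minB_maxB_eq_of_normB_eq {t t' : Fin (a + b) → ℝ} (hd : T.denB t ≠ 0)
    (hd' : T.denB t' ≠ 0) (h : T.normB t = T.normB t') {x : Fin (a + b + 2)} (hx : x ∈ T.B) :
    pointRatio (a + b) T.minB T.maxB x t = pointRatio (a + b) T.minB T.maxB x t' := by
  rcases T.eq_minB_or_eq_maxB_or_exists hx with rfl | rfl | ⟨j, rfl⟩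
  · rw [pointRatio_left, pointRatio_left]
  · rw [pointRatio_right hd, pointRatio_right hd']
  · exact congr_fun h j

/-- **`f(t)` determines the `(lo, hi)`-normalised position of every marked point** (place the
common points `lo, hi, ∞` at `0, 1, ∞`; each remaining point is then read off the factor that
remembers it). [Brown 2009, §2.7 ("The map `f` is an embedding, because …")] [cite: BrownENS2009, §2.7] -/
theorem pointRatio_lo_hi_eq_of_prodMap_eq {t t' : Fin (a + b) → ℝ}
    (ht : Function.Injective (markedPoint (a + b) t)) (ht' : Function.Injective (markedPoint (a + b) t'))
    (h : T.prodMap t = T.prodMap t') (x : Fin (a + b + 2)) :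
    pointRatio (a + b) T.lo T.hi x t = pointRatio (a + b) T.lo T.hi x t' := by
  have hlo := Finset.mem_inter.mp T.lo_mem
  have hhi := Finset.mem_inter.mp T.hi_mem
  have hnA : T.normA t = T.normA t' := by
    ext i; simpa using congr_fun h (Fin.castAdd b i)
  have hnB : T.normB t = T.normB t' := by
    ext j; simpa using congr_fun h (Fin.natAdd a j)
  rcases T.mem_A_or_mem_B x with hx | hx
  · have e := fun {y} (hy : y ∈ T.A) => T.pointRatio_minA_maxA_eq_of_normA_eq
      (T.denA_ne_zero_of_injective ht) (T.denA_ne_zero_of_injective ht') hnA hy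
    rw [← pointRatio_pointRatio (α := T.minA) (β := T.maxA) (T.denA_ne_zero_of_injective ht),
      ← pointRatio_pointRatio (α := T.minA) (β := T.maxA) (T.denA_ne_zero_of_injective ht'),
      e hx, e hlo.1, e hhi.1]
  · have e := fun {y} (hy : y ∈ T.B) => T.pointRatio_minB_maxB_eq_of_normB_eq
      (T.denB_ne_zero_of_injective ht) (T.denB_ne_zero_of_injective ht') hnB hy
    rw [← pointRatio_pointRatio (α := T.minB) (β := T.maxB) (T.denB_ne_zero_of_injective ht),
      ← pointRatio_pointRatio (α := T.minB) (β := T.maxB) (T.denB_ne_zero_of_injective ht'),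
      e hx, e hlo.2, e hhi.2]

/-- **The product map is injective on the generic locus** `{t | the marked points of t are
pairwise distinct}` (which contains every cell `X_σ`): `f_{T₁} × f_{T₂}` is an embedding of
`M_{0,S}`. [Brown 2009, §2.7; Brown–Carr–Schneps 2010, §2.3.2 ("`f` is a birational embedding")]
[cite: BrownENS2009, §2.7] -/
theorem injOn_prodMap :
    InjOn T.prodMap {t : Fin (a + b) → ℝ | Function.Injective (markedPoint (a + b) t)} := by
  intro t ht t' ht' h
  have key := T.pointRatio_lo_hi_eq_of_prodMap_eq ht ht' h
  have hE : markedPoint (a + b) t T.hi - markedPoint (a + b) t T.lo ≠ 0 :=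
    sub_ne_zero.mpr fun h => T.lo_lt_hi.ne' (ht h)
  have hE' : markedPoint (a + b) t' T.hi - markedPoint (a + b) t' T.lo ≠ 0 :=
    sub_ne_zero.mpr fun h => T.lo_lt_hi.ne' (ht' h)
  simp only [pointRatio] at key
  generalize markedPoint (a + b) t T.lo = L at key hE
  generalize markedPoint (a + b) t T.hi = H at key hE
  generalize markedPoint (a + b) t' T.lo = L' at key hE'
  generalize markedPoint (a + b) t' T.hi = H' at key hE'
  have h0 := key 0
  have h1 := key (Fin.last _)
  simp only [markedPoint_zero, markedPoint_last] at h0 h1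
  have hEE : H - L = H' - L' := by
    have h2 : (1 - L) / (H - L) - (0 - L) / (H - L) =
        (1 - L') / (H' - L') - (0 - L') / (H' - L') := by rw [h0, h1]
    rw [div_sub_div_same, div_sub_div_same] at h2
    have h3 : (1 : ℝ) / (H - L) = 1 / (H' - L') := by convert h2 using 2 <;> ring
    rwa [one_div, one_div, inv_inj] at h3
  have hLL : L = L' := by
    rw [← hEE, div_left_inj' hE] at h0
    linarith
  apply eq_of_markedPoint_eq
  funext x
  have hx := key x
  rw [← hEE, ← hLL, div_left_inj' hE] at hx
  linarith

/-- **The product map is injective on every cell.** [Brown 2009, §2.7] [folklore] -/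
theorem injOn_prodMap_shuffleCell (σ : Equiv.Perm (Fin (a + b + 2))) :
    InjOn T.prodMap (shuffleCell (a + b) σ) :=
  T.injOn_prodMap.mono fun _ ht => injective_markedPoint_of_mem_shuffleCell ht


/-- **The images of distinct shuffle cells under the product map are disjoint** (`f` is injective
on the generic locus, which is the disjoint union of the cells). [Brown–Carr–Schneps 2010,
Prop. 2.19 ("`f⁻¹(X_{γ₁} × X_{γ₂})` decomposes into a disjoint union of cells")] [cite: BrownCarrSchneps2010, Prop. 2.19] -/
theorem disjoint_image_prodMap {σ τ : Equiv.Perm (Fin (a + b + 2))} (h : σ ≠ τ) :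
    Disjoint (T.prodMap '' shuffleCell (a + b) σ) (T.prodMap '' shuffleCell (a + b) τ) := by
  refine Set.disjoint_left.mpr ?_
  rintro _ ⟨t, ht, rfl⟩ ⟨t', ht', he⟩
  have := T.injOn_prodMap (injective_markedPoint_of_mem_shuffleCell ht')
    (injective_markedPoint_of_mem_shuffleCell ht) he
  subst this
  exact h (eq_of_mem_shuffleCell ht ht')

/-- `f` is a `ℚ`-semialgebraic map on every `ℚ`-semialgebraic set on which its two denominators
do not vanish (e.g. on every cell). [Kontsevich–Zagier 2001, §1.2 rule (2)] [folklore] -/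
theorem isSemialgebraicMapOn_prodMap {s : Set (Fin (a + b) → ℝ)}
    (hs : Literature.ModelTheory.ExponentialFields.IsSemialgebraic ℚ s)
    (hA : ∀ t ∈ s, T.denA t ≠ 0) (hB : ∀ t ∈ s, T.denB t ≠ 0) : IsSemialgebraicMapOn ℚ s T.prodMap := by
  refine IsSemialgebraicMapOn.of_forall hs fun j => ?_
  induction j using Fin.addCases with
  | left i =>
    simp only [prodMap_castAdd]
    exact isSemialgebraicFunOn_pointRatio _ _ _ hs hA
  | right j =>
    simp only [prodMap_natAdd]
    exact isSemialgebraicFunOn_pointRatio _ _ _ hs hB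

/-- `f` is `ℚ`-semialgebraic on every cell. [Kontsevich–Zagier 2001, §1.2 rule (2)] [folklore] -/
theorem isSemialgebraicMapOn_prodMap_shuffleCell (σ : Equiv.Perm (Fin (a + b + 2))) :
    IsSemialgebraicMapOn ℚ (shuffleCell (a + b) σ) T.prodMap :=
  T.isSemialgebraicMapOn_prodMap (isSemialgebraic_shuffleCell _ σ)
    (fun _ ht => T.denA_ne_zero_of_injective (injective_markedPoint_of_mem_shuffleCell ht))
    (fun _ ht => T.denB_ne_zero_of_injective (injective_markedPoint_of_mem_shuffleCell ht))

/-- `f` is differentiable wherever its two denominators do not vanish. [folklore] -/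
theorem differentiableAt_prodMap {t : Fin (a + b) → ℝ} (hA : T.denA t ≠ 0) (hB : T.denB t ≠ 0) :
    DifferentiableAt ℝ T.prodMap t := by
  refine differentiableAt_pi.mpr fun j => ?_
  induction j using Fin.addCases with
  | left i =>
    simp only [prodMap_castAdd]
    exact differentiableAt_pointRatio _ _ _ hA
  | right j =>
    simp only [prodMap_natAdd]
    exact differentiableAt_pointRatio _ _ _ hB

/-- `f` is differentiable on every cell. [folklore] -/
theorem differentiableAt_prodMap_of_mem_shuffleCell {σ : Equiv.Perm (Fin (a + b + 2))}
    {t : Fin (a + b) → ℝ} (ht : t ∈ shuffleCell (a + b) σ) : DifferentiableAt ℝ T.prodMap t :=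
  T.differentiableAt_prodMap
    (T.denA_ne_zero_of_injective (injective_markedPoint_of_mem_shuffleCell ht))
    (T.denB_ne_zero_of_injective (injective_markedPoint_of_mem_shuffleCell ht))

end GenusZeroProductType

end KZ

end Literature.NumberTheory.Transcendental
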